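import Mathlib
import Literature.NumberTheory.Transcendental.KZCalculus
import Literature.NumberTheory.Transcendental.SemialgebraicMapsProofs
import Literature.NumberTheory.Transcendental.KZProductIdeal
import Literature.NumberTheory.Transcendental.KZLogCalculusProofs
import Summits.KontsevichZagierPeriods.KontsevichZagierPeriods.Theorems.TorsionLogsNeronTorsionSectorStubHaarReps
import Summits.KontsevichZagierPeriods.KontsevichZagierPeriods.Theorems.TorsionLogsNeronTorsionSectorStubProductCoV
import Summits.KontsevichZagierPeriods.KontsevichZagierPeriods.Theorems.TorsionLogsNeronTorsionSectorStubFibreNLWeighted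
import HarnessLib

/-!
# Stub `stub_translationStep` — crux `TorsionLogs.NeronTorsionSector`, line `registered` (block V1)

The generic TRANSLATION STEP of the Kontsevich–Zagier chain on the real torus of
`y² = 4x³ − g₂x − g₃`: Kontsevich–Zagier's rule (2) for the **diagonal product map**
`Φ(x, x′) = (φ(x), ψ(x′))` of the plane, followed by rule (1b) (additivity of the integrand) and the
weighted fibre rule (3) (`stub_fibreNLWeighted`).

Data: base/fibre maps `φ : A → A′`, `ψ : B → B′` (injective, differentiable, `ℚ`-semialgebraic) with
the HAAR IDENTITIES `u₀(φ x)·|φ′ x| = w₀ x`, `u₁(ψ x′)·|ψ′ x′| = w₁ x′` (weights `w` on the source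
chart, `u` on the target chart, `w₀, w₁ ≥ 0` integrable), bounded kernels `kS` on `B`, `kT` on `B′`,
an open band `S = {x ∈ A, c x < x′ < d x}` whose fibres lie in `B`, and a potential `Q` on `J ⊇` the
closed fibres with `Q′ = −(kT∘ψ − kS)·w₁` on the open fibres. For the source representation
`rS = [S, kS(x′) w₀(x) w₁(x′)]`, the target representation `rT = [Φ(S), kT(x′) u₀(x) u₁(x′)]` and
the output `rO = [A, (Q(c x) − Q(d x)) w₀(x)]`:
`[rT] − [rS] − [rO] ∈ KZ.relations`.

Proof. Two intermediate representations on `S` are constructed: the pull-back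
`rP = [S, kT(ψ x′) w₀(x) w₁(x′)]` and the band `rB = [S, (kT(ψ x′) − kS(x′)) w₀(x) w₁(x′)]`
(integrands `ℚ`-semialgebraic by the closure rules `IsSemialgebraicFunOn.mul_holds/.sub_holds/
.comp_isSemialgebraicMapOn_holds`; absolutely integrable by domination with
`Cb · w₀(x) · w₁(x′)`, a product of integrable functions of separate variables,
`MeasureTheory.Integrable.fintype_prod`). Then
* `[rP] − [rT]` is ONE move of `KZ.changeOfVariablesRel` with `Φ′ = diag(φ′(x), ψ′(x′))`
  (`translStep_hasFDerivAt_diagMap`, `|det Φ′| = |φ′ x|·|ψ′ x′|`, the two Haar identities);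
* `[rP] − [rS] − [rB]` is ONE move of `KZ.integrandAddRel`;
* `[rB] − [rO]` is the landed weighted fibre rule `stub_fibreNLWeighted` with `k = kT∘ψ − kS`.

References: M. Kontsevich, D. Zagier, *Periods* (2001), §1.2 rules (1)–(3); J. Bochnak, M. Coste,
M.-F. Roy, *Real Algebraic Geometry* (1998), §2.2, Prop. 2.2.6.
-/

noncomputable section

-- `Summit.KontsevichZagierPeriods.KontsevichZagierPeriods.…` is the tree's mandated layout (single-conjunct summit).
set_option linter.dupNamespace false

open Set MeasureTheory MvPolynomial
open Literature.NumberTheory.Transcendental Literature.ModelTheory.ExponentialFields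
open Literature.NumberTheory.Transcendental.KZ

namespace Summit.KontsevichZagierPeriods.KontsevichZagierPeriods.Cruxes.NeronTorsionSector.Translation

/-- **The diagonal linear map `diag(a, b)` of the plane acts coordinatewise**:
`diag(a, b) v = (a v₀, b v₁)`. [folklore] -/
theorem translStep_diagDeriv_apply (a b : ℝ) (v : Fin 2 → ℝ) :
    (LinearMap.toContinuousLinearMap (Matrix.toLin' (Matrix.diagonal ![a, b])) :
      (Fin 2 → ℝ) →L[ℝ] (Fin 2 → ℝ)) v = fun i => ![a, b] i * v i := by
  ext i
  simp [Matrix.mulVec_diagonal]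

/-- **The determinant of `diag(a, b)` is `a · b`.** [folklore] -/
theorem translStep_det_diagDeriv (a b : ℝ) :
    (LinearMap.toContinuousLinearMap (Matrix.toLin' (Matrix.diagonal ![a, b])) :
      (Fin 2 → ℝ) →L[ℝ] (Fin 2 → ℝ)).det = a * b := by
  show LinearMap.det (Matrix.toLin' (Matrix.diagonal ![a, b])) = _
  rw [LinearMap.det_toLin', Matrix.det_diagonal]
  simp [Fin.prod_univ_two]

/-- **Derivative of the diagonal product map `Φ(x, x′) = (φ(x), ψ(x′))`.** If `φ` has derivative `a`
at `z₀` and `ψ` has derivative `b` at `z₁`, then `z ↦ (φ(z₀), ψ(z₁))` has at `z` the diagonal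
derivative `diag(a, b)` (chain rule through the coordinate projections, `hasFDerivAt_pi''`).
[folklore] -/
theorem translStep_hasFDerivAt_diagMap {φ ψ : ℝ → ℝ} {a b : ℝ} {z : Fin 2 → ℝ}
    (hφ : HasDerivAt φ a (z 0)) (hψ : HasDerivAt ψ b (z 1)) :
    HasFDerivAt (fun w : Fin 2 → ℝ => (![φ (w 0), ψ (w 1)] : Fin 2 → ℝ))
      (LinearMap.toContinuousLinearMap (Matrix.toLin' (Matrix.diagonal ![a, b]))) z := by
  refine hasFDerivAt_pi'' (Fin.forall_fin_two.mpr ⟨?_, ?_⟩)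
  · have h1 := hφ.comp_hasFDerivAt z (hasFDerivAt_apply (𝕜 := ℝ) 0 z)
    have he : (ContinuousLinearMap.proj 0).comp
        (LinearMap.toContinuousLinearMap (Matrix.toLin' (Matrix.diagonal ![a, b])) :
          (Fin 2 → ℝ) →L[ℝ] (Fin 2 → ℝ)) =
        a • (ContinuousLinearMap.proj 0 : (Fin 2 → ℝ) →L[ℝ] ℝ) := by
      ext v
      simp [translStep_diagDeriv_apply]
    rw [he]
    simpa [Function.comp_def] using h1
  · have h1 := hψ.comp_hasFDerivAt z (hasFDerivAt_apply (𝕜 := ℝ) 1 z)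
    have he : (ContinuousLinearMap.proj 1).comp
        (LinearMap.toContinuousLinearMap (Matrix.toLin' (Matrix.diagonal ![a, b])) :
          (Fin 2 → ℝ) →L[ℝ] (Fin 2 → ℝ)) =
        b • (ContinuousLinearMap.proj 1 : (Fin 2 → ℝ) →L[ℝ] ℝ) := by
      ext v
      simp [translStep_diagDeriv_apply]
    rw [he]
    simpa [Function.comp_def] using h1

/-- **A subset `A ⊆ ℝ` whose cylinder `{t : ℝ¹ | t 0 ∈ A}` is `ℚ`-semialgebraic is Lebesgue
measurable** (semialgebraic sets are Borel, `IsSemialgebraic.measurableSet_holds`; pull back along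
the measurable diagonal `x ↦ (x)`). [cite: BochnakCosteRoy1998, §2.2] -/
theorem translStep_measurableSet_of_fin_one {A : Set ℝ}
    (hA : IsSemialgebraic ℚ {t : Fin 1 → ℝ | t 0 ∈ A}) : MeasurableSet A := by
  have hm : MeasurableSet {t : Fin 1 → ℝ | t 0 ∈ A} := IsSemialgebraic.measurableSet_holds hA
  have hpre : A = (fun x : ℝ => fun _ : Fin 1 => x) ⁻¹' {t : Fin 1 → ℝ | t 0 ∈ A} := by
    ext x
    simp only [mem_preimage, mem_setOf_eq]
  rw [hpre]
  exact hm.preimage (measurable_pi_lambda _ fun _ => measurable_id)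

/-- **Domination by a product of two one-variable integrable functions.** On a measurable
`S ⊆ ℝ²`, a function `F` which is measurable on `S` and bounded there by `M · W₀(z₀) · W₁(z₁)` with
`W₀`, `W₁` integrable on `ℝ` is integrable on `S` (`MeasureTheory.Integrable.fintype_prod`,
`Integrable.mono'`). [cite: KontsevichZagier2001, §1.1] -/
theorem translStep_integrableOn_of_abs_le {W₀ W₁ : ℝ → ℝ} (h₀ : Integrable W₀) (h₁ : Integrable W₁)
    {S : Set (Fin 2 → ℝ)} (hS : MeasurableSet S) {F : (Fin 2 → ℝ) → ℝ}
    (hF : Measurable (S.restrict F)) (M : ℝ)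
    (hbound : ∀ z ∈ S, |F z| ≤ M * (W₀ (z 0) * W₁ (z 1))) : IntegrableOn F S := by
  have hG' : Integrable (fun z : Fin 2 → ℝ => ∏ i, (![W₀, W₁] : Fin 2 → ℝ → ℝ) i (z i))
      (volume : Measure (Fin 2 → ℝ)) :=
    Integrable.fintype_prod (μ := fun _ : Fin 2 => (volume : Measure ℝ)) (f := ![W₀, W₁])
      (Fin.forall_fin_two.mpr ⟨by simpa using h₀, by simpa using h₁⟩)
  have hG : Integrable (fun z : Fin 2 → ℝ => W₀ (z 0) * W₁ (z 1)) (volume : Measure (Fin 2 → ℝ)) := by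
    simpa [Fin.prod_univ_two] using hG'
  refine Integrable.mono' ((hG.const_mul M).integrableOn) ?_ ?_
  · exact (aemeasurable_restrict_of_measurable_subtype hS hF).aestronglyMeasurable
  · filter_upwards [ae_restrict_mem hS] with z hz
    rw [Real.norm_eq_abs]
    exact hbound z hz

/-- **STUB V1 (`stub_translationStep`) — one TRANSLATION STEP of the chain = rule (2) for a diagonal
product map + rule (1b) + the weighted fibre rule (3).** Data: base/fibre maps `φ : A → A′`,
`ψ : B → B′` (injective, differentiable, `ℚ`-semialgebraic) with the HAAR IDENTITIES
`u₀(φ x)|φ′ x| = w₀ x`, `u₁(ψ x′)|ψ′ x′| = w₁ x′`, bounded kernels `kS` on `B`, `kT` on `B′`, a band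
`S = {x ∈ A, c x < x′ < d x}` with fibres inside `B`, and a potential `Q` on `J ⊇` the closed fibres
with `Q′ = −(kT∘ψ − kS)·w₁` on the open fibres. Then for the source rep `rS = [S, kS(x′) w₀(x) w₁(x′)]`,
the target rep `rT = [Φ(S), kT(x′) u₀(x) u₁(x′)]` (`Φ = φ × ψ`) and the output
`rO = [A, (Q(c x) − Q(d x)) w₀(x)]`: `[rT] − [rS] − [rO] ∈ KZ.relations`. Proof: pull `rT` back by `Φ`
(one `KZ.changeOfVariablesRel` with `Φ′ = diag(φ′, ψ′)`, `translStep_hasFDerivAt_diagMap`,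
`translStep_det_diagDeriv`), split the pulled-back integrand
`kT(ψ x′) w₀ w₁ = kS(x′) w₀ w₁ + (kT(ψ x′) − kS x′) w₀ w₁` (`KZ.integrandAddRel`; the intermediate reps
exist by `translStep_integrableOn_of_abs_le`), and apply the landed `stub_fibreNLWeighted` to the
second piece. [cite: KontsevichZagier2001, §1.2 rules (1)–(3)] -/
theorem stub_translationStep :
    ∀ (φ φ' ψ ψ' kS kT w₀ w₁ u₀ u₁ Q c d : ℝ → ℝ) (A B A' B' J : Set ℝ) (Cb : ℝ)
      (rS rT : Literature.NumberTheory.Transcendental.KZ.IntegralRep 2)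
      (rO : Literature.NumberTheory.Transcendental.KZ.IntegralRep 1),
    IsSemialgebraic ℚ {t : Fin 1 → ℝ | t 0 ∈ A} → IsSemialgebraic ℚ {t : Fin 1 → ℝ | t 0 ∈ B} →
    IsSemialgebraic ℚ {t : Fin 1 → ℝ | t 0 ∈ A'} → IsSemialgebraic ℚ {t : Fin 1 → ℝ | t 0 ∈ B'} →
    IsSemialgebraic ℚ {t : Fin 1 → ℝ | t 0 ∈ J} →
    IsSemialgebraicFunOn ℚ {t : Fin 1 → ℝ | t 0 ∈ A} (fun t => φ (t 0)) →
    IsSemialgebraicFunOn ℚ {t : Fin 1 → ℝ | t 0 ∈ B} (fun t => ψ (t 0)) →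
    Set.InjOn φ A → Set.InjOn ψ B → Set.MapsTo φ A A' → Set.MapsTo ψ B B' →
    (∀ x ∈ A, HasDerivAt φ (φ' x) x ∧ u₀ (φ x) * |φ' x| = w₀ x) →
    (∀ x ∈ B, HasDerivAt ψ (ψ' x) x ∧ u₁ (ψ x) * |ψ' x| = w₁ x) →
    IsSemialgebraicFunOn ℚ {t : Fin 1 → ℝ | t 0 ∈ A} (fun t => w₀ (t 0)) →
    IsSemialgebraicFunOn ℚ {t : Fin 1 → ℝ | t 0 ∈ B} (fun t => w₁ (t 0)) →
    IsSemialgebraicFunOn ℚ {t : Fin 1 → ℝ | t 0 ∈ A'} (fun t => u₀ (t 0)) →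
    IsSemialgebraicFunOn ℚ {t : Fin 1 → ℝ | t 0 ∈ B'} (fun t => u₁ (t 0)) →
    IsSemialgebraicFunOn ℚ {t : Fin 1 → ℝ | t 0 ∈ B} (fun t => kS (t 0)) →
    IsSemialgebraicFunOn ℚ {t : Fin 1 → ℝ | t 0 ∈ B'} (fun t => kT (t 0)) →
    (∀ x ∈ B, |kS x| ≤ Cb) → (∀ x ∈ B', |kT x| ≤ Cb) →
    (∀ x ∈ A, 0 ≤ w₀ x) → (∀ x ∈ B, 0 ≤ w₁ x) →
    MeasureTheory.IntegrableOn w₀ A → MeasureTheory.IntegrableOn w₁ B →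
    IsSemialgebraicFunOn ℚ {t : Fin 1 → ℝ | t 0 ∈ A} (fun t => c (t 0)) →
    IsSemialgebraicFunOn ℚ {t : Fin 1 → ℝ | t 0 ∈ A} (fun t => d (t 0)) →
    (∀ x ∈ A, c x < d x) → (∀ x ∈ A, Set.Icc (c x) (d x) ⊆ J) → (∀ x ∈ A, Set.Ioo (c x) (d x) ⊆ B) →
    IsSemialgebraicFunOn ℚ {t : Fin 1 → ℝ | t 0 ∈ J} (fun t => Q (t 0)) →
    (∀ x ∈ A, ContinuousOn Q (Set.Icc (c x) (d x))) →
    (∀ x ∈ A, ∀ x' ∈ Set.Ioo (c x) (d x), HasDerivAt Q (-((kT (ψ x') - kS x') * w₁ x')) x') →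
    rS.domain = {z | z 0 ∈ A ∧ c (z 0) < z 1 ∧ z 1 < d (z 0)} →
    Set.EqOn rS.integrand (fun z => kS (z 1) * w₀ (z 0) * w₁ (z 1)) rS.domain →
    rT.domain = (fun z : Fin 2 → ℝ => (![φ (z 0), ψ (z 1)] : Fin 2 → ℝ)) '' rS.domain →
    Set.EqOn rT.integrand (fun z => kT (z 1) * u₀ (z 0) * u₁ (z 1)) rT.domain →
    rO.domain = {t | t 0 ∈ A} →
    Set.EqOn rO.integrand (fun t => (Q (c (t 0)) - Q (d (t 0))) * w₀ (t 0)) rO.domain →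
    Literature.NumberTheory.Transcendental.KZ.of rT - Literature.NumberTheory.Transcendental.KZ.of rS
      - Literature.NumberTheory.Transcendental.KZ.of rO ∈ Literature.NumberTheory.Transcendental.KZ.relations := by
  intro φ φ' ψ ψ' kS kT w₀ w₁ u₀ u₁ Q c d A B A' B' J Cb rS rT rO hA hB _hA' _hB' hJ hφ hψ hφinj hψinj
    _hφmaps hψmaps hφder hψder hw₀ hw₁ _hu₀ _hu₁ hkS hkT hkSb hkTb hw₀nn hw₁nn hw₀int hw₁int hc hd
    hcd hJcd hBcd hQ hQc hQd hSd hSi hTd hTi hOd hOi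
  -- membership in the source band `S = rS.domain ⊆ A × B`
  have hmemS : ∀ z, z ∈ rS.domain ↔ z 0 ∈ A ∧ c (z 0) < z 1 ∧ z 1 < d (z 0) := fun z => by
    rw [hSd, mem_setOf_eq]
  have hS0 : ∀ z ∈ rS.domain, z 0 ∈ A := fun z hz => ((hmemS z).1 hz).1
  have hS1 : ∀ z ∈ rS.domain, z 1 ∈ B := fun z hz => by
    obtain ⟨hzA, h1, h2⟩ := (hmemS z).1 hz
    exact hBcd (z 0) hzA ⟨h1, h2⟩
  have hS1' : ∀ z ∈ rS.domain, ψ (z 1) ∈ B' := fun z hz => hψmaps (hS1 z hz)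
  have hSsa : IsSemialgebraic ℚ rS.domain := rS.isSemialgebraic_domain
  -- `ℚ`-semialgebraic functions on `S`: coordinates, `φ ∘ pr₀`, `ψ ∘ pr₁`, weights, kernels
  have hZ0 : IsSemialgebraicFunOn ℚ rS.domain (fun z => z 0) :=
    (isSemialgebraicFunOn_aeval hSsa (X 0 : MvPolynomial (Fin 2) ℚ)).congr fun z _ => by simp
  have hZ1 : IsSemialgebraicFunOn ℚ rS.domain (fun z => z 1) :=
    (isSemialgebraicFunOn_aeval hSsa (X 1 : MvPolynomial (Fin 2) ℚ)).congr fun z _ => by simp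
  have hproj0 : IsSemialgebraicMapOn ℚ rS.domain (fun z (_ : Fin 1) => z 0) :=
    IsSemialgebraicMapOn.of_forall hSsa fun _ => hZ0
  have hproj1 : IsSemialgebraicMapOn ℚ rS.domain (fun z (_ : Fin 1) => z 1) :=
    IsSemialgebraicMapOn.of_forall hSsa fun _ => hZ1
  have hφS : IsSemialgebraicFunOn ℚ rS.domain (fun z => φ (z 0)) :=
    IsSemialgebraicFunOn.comp_isSemialgebraicMapOn_holds (g := fun t : Fin 1 → ℝ => φ (t 0)) hφ
      hproj0 fun z hz => hS0 z hz
  have hψS : IsSemialgebraicFunOn ℚ rS.domain (fun z => ψ (z 1)) :=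
    IsSemialgebraicFunOn.comp_isSemialgebraicMapOn_holds (g := fun t : Fin 1 → ℝ => ψ (t 0)) hψ
      hproj1 fun z hz => hS1 z hz
  have hw₀S : IsSemialgebraicFunOn ℚ rS.domain (fun z => w₀ (z 0)) :=
    IsSemialgebraicFunOn.comp_isSemialgebraicMapOn_holds (g := fun t : Fin 1 → ℝ => w₀ (t 0)) hw₀
      hproj0 fun z hz => hS0 z hz
  have hw₁S : IsSemialgebraicFunOn ℚ rS.domain (fun z => w₁ (z 1)) :=
    IsSemialgebraicFunOn.comp_isSemialgebraicMapOn_holds (g := fun t : Fin 1 → ℝ => w₁ (t 0)) hw₁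
      hproj1 fun z hz => hS1 z hz
  have hkSS : IsSemialgebraicFunOn ℚ rS.domain (fun z => kS (z 1)) :=
    IsSemialgebraicFunOn.comp_isSemialgebraicMapOn_holds (g := fun t : Fin 1 → ℝ => kS (t 0)) hkS
      hproj1 fun z hz => hS1 z hz
  have hψmap : IsSemialgebraicMapOn ℚ rS.domain (fun z (_ : Fin 1) => ψ (z 1)) :=
    IsSemialgebraicMapOn.of_forall hSsa fun _ => hψS
  have hkTS : IsSemialgebraicFunOn ℚ rS.domain (fun z => kT (ψ (z 1))) :=
    IsSemialgebraicFunOn.comp_isSemialgebraicMapOn_holds (g := fun t : Fin 1 → ℝ => kT (t 0)) hkT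
      hψmap fun z hz => hS1' z hz
  -- the two intermediate integrands: the pull-back `kT(ψ x′) w₀ w₁` and the band
  -- `(kT(ψ x′) − kS x′) w₀ w₁`
  have hFPsa : IsSemialgebraicFunOn ℚ rS.domain (fun z => kT (ψ (z 1)) * w₀ (z 0) * w₁ (z 1)) :=
    (IsSemialgebraicFunOn.mul_holds (IsSemialgebraicFunOn.mul_holds hkTS hw₀S) hw₁S).congr
      fun z _ => rfl
  have hFBsa : IsSemialgebraicFunOn ℚ rS.domain
      (fun z => (kT (ψ (z 1)) - kS (z 1)) * w₀ (z 0) * w₁ (z 1)) :=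
    (IsSemialgebraicFunOn.mul_holds (IsSemialgebraicFunOn.mul_holds
      (IsSemialgebraicFunOn.sub_holds hkTS hkSS) hw₀S) hw₁S).congr fun z _ => rfl
  -- integrability: domination by `Cb · w₀(z 0) · w₁(z 1)` (`w₀`, `w₁` extended by zero)
  have hAm : MeasurableSet A := translStep_measurableSet_of_fin_one hA
  have hBm : MeasurableSet B := translStep_measurableSet_of_fin_one hB
  have hW₀ : Integrable (A.indicator w₀) := hw₀int.integrable_indicator hAm
  have hW₁ : Integrable (B.indicator w₁) := hw₁int.integrable_indicator hBm
  have hSm : MeasurableSet rS.domain := IsSemialgebraic.measurableSet_holds hSsa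
  have hprod : ∀ z ∈ rS.domain,
      |w₀ (z 0) * w₁ (z 1)| = A.indicator w₀ (z 0) * B.indicator w₁ (z 1) := fun z hz => by
    rw [indicator_of_mem (hS0 z hz), indicator_of_mem (hS1 z hz),
      abs_of_nonneg (mul_nonneg (hw₀nn _ (hS0 z hz)) (hw₁nn _ (hS1 z hz)))]
  have hFPint : IntegrableOn (fun z => kT (ψ (z 1)) * w₀ (z 0) * w₁ (z 1)) rS.domain := by
    refine translStep_integrableOn_of_abs_le hW₀ hW₁ hSm
      (measurable_restrict_of_isSemialgebraicFunOn hFPsa) Cb fun z hz => ?_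
    rw [mul_assoc, abs_mul, ← hprod z hz]
    exact mul_le_mul_of_nonneg_right (hkTb _ (hS1' z hz)) (abs_nonneg _)
  have hFBint : IntegrableOn (fun z => (kT (ψ (z 1)) - kS (z 1)) * w₀ (z 0) * w₁ (z 1))
      rS.domain := by
    refine translStep_integrableOn_of_abs_le hW₀ hW₁ hSm
      (measurable_restrict_of_isSemialgebraicFunOn hFBsa) (Cb + Cb) fun z hz => ?_
    rw [mul_assoc, abs_mul, ← hprod z hz]
    refine mul_le_mul_of_nonneg_right ?_ (abs_nonneg _)
    exact (abs_sub _ _).trans (add_le_add (hkTb _ (hS1' z hz)) (hkSb _ (hS1 z hz)))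
  -- the two intermediate representations
  obtain ⟨rP, hrPd, hrPi⟩ : ∃ r : IntegralRep 2, r.domain = rS.domain ∧
      r.integrand = fun z => kT (ψ (z 1)) * w₀ (z 0) * w₁ (z 1) :=
    ⟨⟨_, _, hSsa, hFPsa, hFPint⟩, rfl, rfl⟩
  obtain ⟨rB, hrBd, hrBi⟩ : ∃ r : IntegralRep 2, r.domain = rS.domain ∧
      r.integrand = fun z => (kT (ψ (z 1)) - kS (z 1)) * w₀ (z 0) * w₁ (z 1) :=
    ⟨⟨_, _, hSsa, hFBsa, hFBint⟩, rfl, rfl⟩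
  -- (i) `[rP] − [rT]`: ONE change of variables along `Φ = φ × ψ`, `Φ′ = diag(φ′(x), ψ′(x′))`
  have h1 : of rP - of rT ∈ relations := by
    refine changeOfVariablesRel_subset_relations
      ⟨2, rP, rT, fun z => ![φ (z 0), ψ (z 1)],
        fun z => LinearMap.toContinuousLinearMap
          (Matrix.toLin' (Matrix.diagonal ![φ' (z 0), ψ' (z 1)])),
        ?_, ?_, ?_, ?_, ?_, rfl⟩
    · -- `Φ` is a `ℚ`-semialgebraic map: both coordinates are `ℚ`-semialgebraic functions
      rw [hrPd]
      refine IsSemialgebraicMapOn.of_forall hSsa (Fin.forall_fin_two.mpr ⟨?_, ?_⟩)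
      · simpa using hφS
      · simpa using hψS
    · -- derivative within the domain
      intro z hz
      rw [hrPd] at hz
      exact (translStep_hasFDerivAt_diagMap (hφder (z 0) (hS0 z hz)).1
        (hψder (z 1) (hS1 z hz)).1).hasFDerivWithinAt
    · -- injective on the domain
      intro z hz z' hz' h
      rw [hrPd] at hz hz'
      have e0 := congr_fun h 0
      have e1 := congr_fun h 1
      simp only [Matrix.cons_val_zero, Matrix.cons_val_one] at e0 e1
      exact funext (Fin.forall_fin_two.mpr
        ⟨hφinj (hS0 z hz) (hS0 z' hz') e0, hψinj (hS1 z hz) (hS1 z' hz') e1⟩)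
    · -- the image domain
      rw [hrPd]
      exact hTd
    · -- the Jacobian factor: the two Haar identities
      intro z hz
      rw [hrPd] at hz
      have hzA : z 0 ∈ A := hS0 z hz
      have hzB : z 1 ∈ B := hS1 z hz
      have hzT : (![φ (z 0), ψ (z 1)] : Fin 2 → ℝ) ∈ rT.domain := by
        rw [hTd]
        exact ⟨z, hz, rfl⟩
      rw [hrPi, hTi hzT, translStep_det_diagDeriv]
      simp only [Matrix.cons_val_zero, Matrix.cons_val_one]
      rw [← (hφder (z 0) hzA).2, ← (hψder (z 1) hzB).2, abs_mul]
      ring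
  -- (ii) `[rP] − [rS] − [rB]`: ONE additivity of the integrand
  have h2 : of rP - of rS - of rB ∈ relations := by
    refine integrandAddRel_subset_relations
      ⟨2, rP, rS, rB, hrPd.symm, hrBd.trans hrPd.symm, fun z hz => ?_, rfl⟩
    rw [hrPd] at hz
    simp only [hrPi, hrBi, Pi.add_apply, hSi hz]
    ring
  -- (iii) `[rB] − [rO]`: the weighted fibre rule with `k = kT ∘ ψ − kS`
  have h3 : of rB - of rO ∈ relations :=
    stub_fibreNLWeighted (fun x' => kT (ψ x') - kS x') Q c d w₀ w₁ A J rB rO hA hc hd hw₀ hcd hJcd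
      hJ hQ hQc hQd (hrBd.trans hSd) (fun z _ => by rw [hrBi]) hOd hOi
  -- assemble
  have e : of rT - of rS - of rO = (of rP - of rS - of rB) - (of rP - of rT) + (of rB - of rO) := by
    abel
  rw [e]
  exact relations.add_mem (relations.sub_mem h2 h1) h3

end Summit.KontsevichZagierPeriods.KontsevichZagierPeriods.Cruxes.NeronTorsionSector.Translation

end
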